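import Summits.CriticalPhenomena.CardyFormulaZ2.Theorems.CardyBoundaryCoulombGasHalfPlaneMarkDensityLawDensityIdentification

/-!
# `HalfPlaneMarkDensityLaw` (crux stmt-CriticalPhenomena-5661), line `Sketch`, dense positivity:
# stub `stub_lawSeq_eventually_ge` (P3) — the density sequence is eventually bounded below along `θ`
# at every fourth mark where `∂₄G > 0`

Pure analysis.  `lawSeq a b c x n = n · P_{1/2}[E_n(a,b,c,x)]` is the crux's own sequence (the lattice
mark density), and for a joint subsequential limit `G` of the collinear half-plane crossing function
along a strictly increasing `θ`, `Density.hasDerivAt_jointLimit` gives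
`lawSeq a b c x (θ j) → ∂₄G(a,b,c,x)` as `j → ∞` on the chamber `a < b < c < x`
(`StrictMono.tendsto_atTop` supplies `θ → ∞`).  If `D := ∂₄G(a,b,c,x) > 0`, then with
`c₁ := D / 2 ∈ (0, D)` the sequence is eventually `≥ c₁` (`Filter.Tendsto.eventually_const_le`).
-/

noncomputable section

namespace Summit.CriticalPhenomena.CardyFormulaZ2.Cruxes.HalfPlaneMarkDensityLaw.SketchLine

open Literature.Probability.Percolation Literature.Probability.LatticeModels
open MeasureTheory Filter Set
open scoped Topology
open Summit.CriticalPhenomena.CardyFormulaZ2.Theorems.HalfPlaneMarkDensityLaw.Negative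

namespace DensePos

/-- STUB P3: along `θ`, the crux's density sequence is eventually bounded below by a positive constant at
every fourth mark where `∂₄G > 0`. [folklore] -/
theorem stub_lawSeq_eventually_ge :
    ∀ {θ : ℕ → ℕ} {G : ℝ → ℝ → ℝ → ℝ → ℝ},
      (∀ a b c y : ℝ, a < b → b < c → c < y →
        Tendsto (fun n ↦ μ.real (openCrossing halfPlane (arcA a b (θ n))
          (rowIcc ⌊c * (θ n : ℕ)⌋ ⌊y * (θ n : ℕ)⌋))) atTop (𝓝 (G a b c y))) →
      StrictMono θ → ∀ {a b c x : ℝ}, a < b → b < c → c < x → 0 < deriv (G a b c) x →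
        ∃ c₁ : ℝ, 0 < c₁ ∧ ∀ᶠ j : ℕ in atTop, c₁ ≤ lawSeq a b c x (θ j) := by
  intro θ G hG hθ a b c x hab hbc hcx hD
  -- the crux's sequence converges along `θ` to `D := ∂₄G(a,b,c,x) > 0`
  have hlim : Tendsto (fun j ↦ lawSeq a b c x (θ j)) atTop (𝓝 (deriv (G a b c) x)) :=
    (Density.hasDerivAt_jointLimit hG hθ.tendsto_atTop hab hbc hcx).2
  -- take `c₁ := D / 2 ∈ (0, D)`
  exact ⟨deriv (G a b c) x / 2, half_pos hD, hlim.eventually_const_le (half_lt_self hD)⟩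

end DensePos

end Summit.CriticalPhenomena.CardyFormulaZ2.Cruxes.HalfPlaneMarkDensityLaw.SketchLine

end
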